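import Literature.Geometry.Lorentzian.KerrDecayHierarchy
import Literature.Geometry.Lorentzian.KerrStarCoord
import HarnessLib

/-!
# DRSR Corollary 3.1, pointwise estimate (30), through the hyperboloidal foliation
# `Σ̃_τ(h♯_{R₁})` (the leaf form), and its equivalence with `drsr_wave_pointwise_decay_kerr`

(statement group **gr.S24**; namespace `Literature.Geometry.Lorentzian.Kerr`, glue in
`Literature.Geometry.Lorentzian`)

`KerrWaveDecay.lean` vendors the pointwise decay estimate (30) of Dafermos–Rodnianski–
Shlapentokh-Rothman (*Decay for solutions of the wave equation on Kerr exterior spacetimes III*,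
arXiv:1402.7034 = Ann. of Math. 183 (2016), "DRSR", §3.3, Cor. 3.1) in **local coordinate
form**, as the named fact `Literature.Geometry.Lorentzian.drsr_wave_pointwise_decay_kerr`:
`|ψ(τ, y)| ≤ C(M, a, δ, R, ψ) τ^{-3/2+δ}` for `τ ≥ 1` at the points `(τ, y)` of the Kerr–Schild
leaves `{t*_KS = τ} ∩ {r > r₊}` with `‖y‖ ≤ R`, for admissible waves `ψ`
(`IsAdmissibleKerrWave`). Its docstring derives that form from the printed estimate through the
identifications (i)–(iii) of the module docstring of `KerrWaveDecay.lean` (the hyperboloidal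
hypersurface `Σ̃₀` of Cor. 3.1 "may be chosen to agree with DRSR's `Σ₀` on `{r ≤ R₁}`", p. 51 of
the arXiv text, so that the portions `{‖y‖ ≤ R}` of the Kerr–Schild leaves lie on leaves `Σ̃_τ`).
Since then the tree has acquired that foliation as a concrete object:
`KerrHyperboloidalFlux.lean` constructs the heights `h♯_{R₁} = Kerr.scriHeight M a R₁` whose
leaves `Σ̃_τ(h♯_{R₁}) = {t*_KS = τ + h♯_{R₁}(y)} = φ_τ Σ̃₀(h♯_{R₁})` **are** the Kerr–Schild slices
on `{r ≤ R₁}` (`Kerr.scriHeight_eq_zero_of_radius_le`), are smooth, spacelike, transversal to `𝓗⁺`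
(`KerrHyperboloidalLeaves.lean`) and terminate at `𝓘⁺`
(`Kerr.integrableOn_outgoingNullSlope_sub_scriSlope`; *The corrected foliation* in the module
docstring of `KerrHyperboloidalFlux.lean`), and vendors the first (energy-flux) estimate of
Cor. 3.1 for it (`Kerr.drsr_corollary_3_1_scri_flux_decay`), from which
`drsr_wave_polynomial_decay_kerr` is *proved*; `KerrDecayHierarchy.lean` reduces that flux
estimate further to Thms. 3.1–3.2 and the `r^p` estimates. This file does the same for (30):

* the **leaf form of (30)** — an explicit `Prop`, written out as the hypothesis of
  `drsr_wave_pointwise_decay_kerr_of_corollary_3_1_scri_pointwise` and as the conclusion of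
  `Kerr.scri_leaf_pointwise_decay_of_drsr_wave_pointwise_decay_kerr` below, **not** a named fact —:
  DRSR Cor. 3.1, estimate (30), for the concrete foliation `Σ̃_τ(h♯_{R₁})` and the data class of
  `Kerr.drsr_corollary_3_1_scri_flux_decay` / `Kerr.drsr_theorems_3_1_3_2_scri` (admissible waves
  with data supported in the coordinate ball `{‖y‖ ≤ R₁}`, `Kerr.HasBallData`, for which
  `ψ_∞ = 0`): `sup_{Σ̃_τ(h♯_{R₁}) ∩ {r₊ < r ≤ R}} |ψ| ≤ C τ^{-3/2+δ}`, `τ ≥ 1`, stated at the leaf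
  points `Kerr.leafPoint (scriHeight M a R₁) τ y = (τ + h♯_{R₁}(y), y)` of the exterior chart. It was
  first vendored here as a named fact of its own, `Kerr.drsr_corollary_3_1_scri_pointwise_decay`
  (D-0014), and has been **merged back** into `drsr_wave_pointwise_decay_kerr` by the D-0026 review
  of that decomposition, the two being *equivalent* (bullets below): one named fact per printed
  estimate, `drsr_wave_pointwise_decay_kerr`, carries (30);
* `Literature.Geometry.Lorentzian.drsr_wave_pointwise_decay_kerr_of_leaf_pointwise_decay`
  (**proved**): the named fact of `KerrWaveDecay.lean` follows from (30) through the leaves of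
  *any* cut-off graph foliation `h = cutoffHeight (σ M a) a R₁` (heights vanishing on
  `{r ≤ R₁}`): given `ψ` with data supported in a compact `K ⊆ {‖x⃗‖ ≤ ρ}`
  (`exists_spatialNorm_le_of_isCompact`), take `R₁ ≥ max(R₀, ρ, R)`; for `‖y‖ ≤ R ≤ R₁` the leaf
  point over `y` is the slice point `(τ, y)` (`Kerr.cutoffHeight_eq_zero_of_norm_le`,
  `Kerr.leafPoint_of_eq_zero`), and `r(τ, y) ≤ ‖y‖ ≤ R ≤ max(R, r₊ + 1)`
  (`Kerr.radius_ofTimeSpace_le_norm`), a radius `> r₊` as (30) requires;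
* `Literature.Geometry.Lorentzian.drsr_wave_pointwise_decay_kerr_of_corollary_3_1_scri_pointwise`
  (**proved**): the instance `σ = Kerr.scriSlope`, i.e. leaf form `→ drsr_wave_pointwise_decay_kerr`;
  and its qualitative corollary `Kerr.tendsto_zero_of_scri_leaf_pointwise_decay` (`ψ(τ, y) → 0`
  along every `∂_{t*}`-line of the exterior, via `drsr_wave_pointwise_decay_kerr.tendsto_zero`);
* `Literature.Geometry.Lorentzian.leaf_pointwise_decay_of_drsr_wave_pointwise_decay_kerr`,
  `Literature.Geometry.Lorentzian.drsr_wave_pointwise_decay_kerr_iff_leaf_pointwise_decay`,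
  `Kerr.scri_leaf_pointwise_decay_of_drsr_wave_pointwise_decay_kerr` and
  `Kerr.scri_leaf_pointwise_decay_iff` (**proved**, the converse reduction): the coordinate form
  *implies* (30) through the leaves of every cut-off graph foliation whose far slopes are
  nonnegative beyond `r₊` — in particular through `Σ̃_τ(h♯_{R₁})` (`Kerr.scriHeight_nonneg`: the
  leaves lie to the future of the slices) —, because an exterior leaf point `(τ + h(y), y)` with
  `r ≤ R` is a slice point at a time `t ≥ τ ≥ 1` with `‖y‖ ≤ r + |a| ≤ R + |a|`
  (`Kerr.norm_le_radius_add_abs`) and `t^{-3/2+δ'} ≤ τ^{-3/2+δ'}` for `δ' = min(δ, 1)`. Hence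
  **leaf form `↔ drsr_wave_pointwise_decay_kerr`**: the former named fact
  `Kerr.drsr_corollary_3_1_scri_pointwise_decay` carried exactly the content of
  `drsr_wave_pointwise_decay_kerr` up to this elementary bookkeeping — the same printed estimate,
  the same citation, the same (XL) proof obligation —, which is why the D-0026 review of the
  decomposition `drsr_wave_pointwise_decay_kerr ⟸ Kerr.drsr_corollary_3_1_scri_pointwise_decay`
  merged it back (the assembly theorems of `KerrPointwiseDecayHierarchy.lean` and
  `KerrSliceAgmon.lean` conclude the leaf form written out).

Hence the local pointwise fact of `KerrWaveDecay.lean` rests on the printed estimate (30) for one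
admissible hyperboloidal foliation, exactly as the local energy facts of `BlackHoles.lean` rest on
the printed flux estimate; nothing else of the identifications (i)–(iii) remains to be trusted
except what is recorded in the docstring of
`drsr_wave_pointwise_decay_kerr_of_corollary_3_1_scri_pointwise` below (the data induced on
`Σ̃₀(h♯_{R₁})` are smooth and compactly supported, so that `E < ∞` and `ψ_∞ = 0`).

## The printed proof of (30) and the next layer

DRSR prove Cor. 3.1 in one sentence (§3.3, p. 14): Thms. 3.1–3.2 hold for admissible `Σ̃₀` of
the second kind (Prop. 4.6.1 of arXiv:1010.5132), "as a consequence of this more general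
statement, the above theorems allow us to apply our black box result of [arXiv:0910.4957] (see
[Schlue] and [Moschidis] for detailed treatments)". For the pointwise estimate (30) the black box
is, in the detailed treatment of Moschidis (arXiv:1509.08489, §1.3.3, restating DRSR Cor. 3.1 with
`sup_{Σ̃_τ} |φ| ≤ C √E τ^{-3/2}`; Thm. 8.1, Thm. 9.1, Cor. 9.2 and the sketch of §9.4): (E1) the
`τ⁻²` decay of the non-degenerate first-order energy through the hyperboloidal leaves (the first
estimate of Cor. 3.1, vendored as `Kerr.drsr_corollary_3_1_scri_flux_decay`); (E2) the improved
`τ^{-4+2δ}` decay of the second-order energy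
`Σ_{i₁+i₂=1} ∫_{Σ̃_τ} (|∇^{i₁+1}(T^{i₂}ψ)|² + r⁻²|T²ψ|²)` (the second estimate of Cor. 3.1 for the
commuted field, upgraded by the elliptic estimates (29) / App. of arXiv:1509.08489); (GN) the
Gagliardo–Nirenberg inequality on the leaves,
`sup_{Σ̃_τ} |ψ|² ≲ (E1-energy)^{1/2} (E2-energy)^{1/2} + (E2-energy)` (arXiv:1509.08489, §9.4 and
§9.8, Lemma 9.10 with `d = 3`), whence `sup |ψ|² ≲ τ⁻¹ · τ^{-2+δ}`. Stating (E2) and (GN)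
faithfully needs the leaf-tangential first and second covariant derivatives and the degenerate
leaf metrics `h_{τ,N}` of arXiv:1509.08489 on `Σ̃_τ(h♯_{R₁})`, which the prelude does not have (a
bounded-domain interpolation inequality on `{‖y‖ ≤ R}` does not suffice: its lower-order terms
decay only like `τ⁻²`); that layer is the business of `KerrPointwiseDecayHierarchy.lean` (the
assembly of the leaf form from the energy-decay estimates (D) = (E1), (E2) and the finiteness of the
radiation field, in Cartesian rendering, and the interpolation inequality (GN), proved) and of
`KerrSliceAgmon.lean` ((GN) proved), whose assembly theorems conclude the leaf form of this file;
their remaining hypothesis (D) — DRSR Cor. 3.1, estimates 1–3 — is the deep part of DRSR.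

## Design choices

* **Statement at leaf points.** (30) is a supremum over `Σ̃_τ ∩ {r ≤ R}`; we state it at the
  points `leafPoint (scriHeight M a R₁) τ y` lying in the open exterior `{r > r₊}` (the printed
  `Σ̃_τ` also contains the horizon sphere `Σ̃_τ ∩ 𝓗⁺`, where our `ψ` is not defined: restricting a
  supremum is a weakening) with `r ≤ R`, `R > r₊` as printed. The radius bound is imposed on the
  leaf point itself (`Kerr.radius` does not depend on `t*`, `Kerr.radius_ofTimeSpace`, so this is
  `r(0, y) ≤ R`).
* **`ψ_∞ = 0` and `E < ∞`** are consequences of the data class (`HasBallData R₁` with `R₁ ≥ R₀`),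
  not extra hypotheses: see (ii) in the docstring of
  `drsr_wave_pointwise_decay_kerr_of_corollary_3_1_scri_pointwise`. The constant is existential and
  depends on `(M, a, R₁, δ, R, ψ)`, absorbing `C(a₀, M, δ, R) √E` with `a₀ := |a|` — weaker than
  the source, never stronger.
* **`τ ≥ 1`.** The printed estimate is read for `τ ≥ 1`; were it asserted only for `τ ≥ τ₀`, the
  remaining range `[1, τ₀]` is covered by the uniform pointwise bound `sup_{Σ̃_τ ∩ {r ≤ R}} |ψ| ≤ C`
  ("uniform pointwise bounds on `|ψ|` … follow as an immediate consequence of the above Theorems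
  in view of the Sobolev inequality applied on each `Σ_τ`", DRSR p. 14, with §3.3) and
  `inf_{[1, τ₀]} τ^{-3/2+δ} > 0`.
* The pointwise derivative estimate (31) (`drsr_wave_derivative_decay_kerr` of
  `KerrWaveDecay.lean`) is **not** treated here: its reduction needs in addition the comparison of
  `|n_Σ̃ ψ| + |∇_Σ̃ ψ|` with the coordinate gradient on `{r ≤ R₁}` (constants `C(M, a, R₁)`).
* **Names.** The theorem names `drsr_wave_pointwise_decay_kerr_of_corollary_3_1_scri_pointwise`
  (here) and `Kerr.drsr_corollary_3_1_scri_pointwise_decay_of_leafEnergy_decay(')`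
  (`KerrPointwiseDecayHierarchy.lean`, `KerrSliceAgmon.lean`) denote the printed estimate — DRSR
  Corollary 3.1 (30) through the foliation terminating at `𝓘⁺` ("scri"), i.e. the leaf form —, not
  a Lean declaration: they were kept when the homonymous named fact was merged (their importers use
  them; a rename would cascade through three files for no mathematical gain). Only the corollary
  that lived in the retired fact's namespace was renamed (`Kerr.tendsto_zero_of_scri_leaf_pointwise_decay`).
* Binders use `Kerr.region a (Kerr.rPlus M a)` for `Kerr.exterior M a` (definitionally equal;
  implementation note of `KerrHyperboloidalFlux.lean`). Imports: `KerrDecayHierarchy` (for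
  `Kerr.HasBallData`; it re-exports `KerrHyperboloidalFlux` and `KerrWaveDecay`) and `KerrStarCoord`
  (for `Kerr.norm_le_radius_add_abs` and, through `KerrHyperboloidalLeaves`, `Kerr.scriSlope_pos`,
  used by the converse reduction).

## References

* M. Dafermos, I. Rodnianski, Y. Shlapentokh-Rothman, *Decay for solutions of the wave equation
  on Kerr exterior spacetimes III: the full subextremal case `|a| < M`*, Ann. of Math. 183 (2016)
  787–913, arXiv:1402.7034: §3.1 Thm. 3.1 and the definition of `ψ_∞` (p. 13 of the arXiv text:
  `4π ψ_∞² = lim_{r'→∞} ∫_{Σ₀ ∩ {r = r'}} r⁻² ψ²`), p. 14 (uniform pointwise bounds by Sobolev),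
  §3.3 (admissible `Σ̃₀`; Cor. 3.1, estimate (30)), §3.4, §4.1 (data; density), p. 51
  (hyperboloidal `Σ̃₀` agreeing with `Σ₀` on `{r ≤ R}`) (key `DafermosRodnianskiShlapentokhrothman2014`).
* G. Moschidis, *The `r^p`-weighted energy method of Dafermos and Rodnianski in general
  asymptotically flat spacetimes and applications*, Ann. PDE 2 (2016), arXiv:1509.08489, §1.3.3
  (restatement of DRSR Cor. 3.1), Def. 3.2, Thm. 8.1, Thm. 9.1, Cor. 9.2, §9.4, §9.8 Lemma 9.10
  (key `Moschidis2016`).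
* M. Dafermos, I. Rodnianski, *Decay for solutions of the wave equation on Kerr exterior
  spacetimes I–II*, arXiv:1010.5132, §4.4 Def. 4.1, Prop. 4.5.1, Prop. 4.6.1
  (key `DafermosRodnianski2010KerrSmallA`); *A new physical-space approach to decay for the wave
  equation*, arXiv:0910.4957, §5 (key `DafermosRodnianski2010ICMP`).
-/

noncomputable section

open Set Filter TopologicalSpace Metric
open scoped Topology ENNReal Manifold ContDiff

namespace Literature.Geometry.Lorentzian

/-! ### Reduction of the coordinate pointwise decay to (30) through the leaves -/

/-- **Reduction of DRSR's pointwise decay (coordinate form) to (30) through the leaves of a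
cut-off graph foliation.** Let `σ M a : ℝ → ℝ` be any family of far slopes and
`h = Kerr.cutoffHeight (σ M a) a R₁` the associated heights (vanishing on `{r ≤ R₁}`). If for
`|a| < M` there is `R₀ > 0` such that for all `R₁ ≥ R₀`, all admissible waves `ψ` with data
supported in `{‖y‖ ≤ R₁}`, all `δ > 0` and all `R > r₊` there is `C` with `|ψ(p)| ≤ C τ^{-3/2+δ}`
(`τ ≥ 1`) at the exterior leaf points `p = Kerr.leafPoint h τ y` with `r(p) ≤ R`, then
`Literature.Geometry.Lorentzian.drsr_wave_pointwise_decay_kerr` (`KerrWaveDecay.lean`: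
`|ψ(τ, y)| ≤ C τ^{-3/2+δ}` at the slice points with `‖y‖ ≤ R`, `τ ≥ 1`) holds: given `ψ` with data
supported in a compact `K ⊆ {‖x⃗‖ ≤ ρ}` (`exists_spatialNorm_le_of_isCompact`) and a coordinate
radius `R`, choose `R₁ = max(R₀, ρ, R)`; on `{‖y‖ ≤ R}` the leaf `Σ̃_τ(h)` is the Kerr–Schild slice
`{t* = τ}` (`Kerr.cutoffHeight_eq_zero_of_norm_le`, `Kerr.leafPoint_of_eq_zero`), and
`r(τ, y) ≤ ‖y‖ ≤ R ≤ max(R, r₊ + 1)` (`Kerr.radius_ofTimeSpace_le_norm`), a radius bound `> r₊`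
as required by (30). DRSR arXiv:1402.7034, §3.3, Cor. 3.1 (30) and p. 51. [cite: DafermosRodnianskiShlapentokhrothman2014, Cor. 3.1 (30) and p. 51] -/
theorem drsr_wave_pointwise_decay_kerr_of_leaf_pointwise_decay (σ : ℝ → ℝ → ℝ → ℝ)
    (hpt : ∀ [Kerr.Facts] [Kerr.SliceFacts] (M a : ℝ), Kerr.IsSubextremal M a →
      ∃ R₀ : ℝ, 0 < R₀ ∧ ∀ R₁ : ℝ, R₀ ≤ R₁ →
        ∀ ψ : Kerr.region a (Kerr.rPlus M a) → ℝ, IsAdmissibleKerrWave M a ψ →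
          Kerr.HasBallData M a R₁ ψ → ∀ δ : ℝ, 0 < δ → ∀ R : ℝ, Kerr.rPlus M a < R →
            ∃ C : ℝ, ∀ τ : ℝ, 1 ≤ τ →
              ∀ (y : E3) (hy : Kerr.leafPoint (Kerr.cutoffHeight (σ M a) a R₁) τ y ∈
                  Kerr.region a (Kerr.rPlus M a)),
                Kerr.radius a (Kerr.leafPoint (Kerr.cutoffHeight (σ M a) a R₁) τ y) ≤ R →
                  |ψ ⟨Kerr.leafPoint (Kerr.cutoffHeight (σ M a) a R₁) τ y, hy⟩| ≤
                    C * τ ^ (-(3 / 2 : ℝ) + δ)) :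
    drsr_wave_pointwise_decay_kerr := by
  intro _ _ M a hMa ψ hψ δ hδ R
  obtain ⟨R₀, hR₀, hcor⟩ := hpt M a hMa
  -- a coordinate ball containing the support of the data
  obtain ⟨K, hK, hsupp⟩ := hψ.2.2
  obtain ⟨ρ, hρ, hKρ⟩ := exists_spatialNorm_le_of_isCompact hK
  set R₁ : ℝ := max R₀ (max ρ R) with hR₁
  have hR₀₁ : R₀ ≤ R₁ := le_max_left _ _
  have hρ₁ : ρ ≤ R₁ := (le_max_left _ _).trans (le_max_right _ _)
  have hRR₁ : R ≤ R₁ := (le_max_right _ _).trans (le_max_right _ _)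
  have hR₁nn : 0 ≤ R₁ := hR₀.le.trans hR₀₁
  -- the support hypothesis in ball form
  have hdata : Kerr.HasBallData M a R₁ ψ := by
    intro x hx0 hxR
    refine hsupp x hx0 fun hxK ↦ ?_
    have := hKρ x hxK
    linarith
  -- a radius bound `> r₊` for (30)
  set R' : ℝ := max R (Kerr.rPlus M a + 1) with hR'
  have hR'pos : Kerr.rPlus M a < R' := (lt_add_one _).trans_le (le_max_right _ _)
  obtain ⟨C, hC⟩ := hcor R₁ hR₀₁ ψ hψ hdata δ hδ R' hR'pos
  refine ⟨C, fun τ hτ y hy hyR ↦ ?_⟩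
  set h : E3 → ℝ := Kerr.cutoffHeight (σ M a) a R₁ with hh
  -- on `{‖y‖ ≤ R}` the leaf point is the slice point `(τ, y)`
  have h0 : h y = 0 := Kerr.cutoffHeight_eq_zero_of_norm_le hR₁nn (hyR.trans hRR₁)
  have hpt : Kerr.leafPoint h τ y = E4.ofTimeSpace τ y := Kerr.leafPoint_of_eq_zero h0 τ
  have hy' : Kerr.leafPoint h τ y ∈ Kerr.region a (Kerr.rPlus M a) := by
    rw [hpt]; exact hy
  have hrad : Kerr.radius a (Kerr.leafPoint h τ y) ≤ R' := by
    rw [hpt]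
    exact ((Kerr.radius_ofTimeSpace_le_norm a τ y).trans hyR).trans (le_max_left _ _)
  have hbound := hC τ hτ y hy' hrad
  -- transport along `leafPoint = ofTimeSpace τ y`
  have heq : (⟨Kerr.leafPoint h τ y, hy'⟩ : Kerr.region a (Kerr.rPlus M a)) =
      ⟨E4.ofTimeSpace τ y, hy⟩ := Subtype.ext hpt
  rw [heq] at hbound
  exact hbound

/-- **Dafermos–Rodnianski–Shlapentokh-Rothman, Corollary 3.1, pointwise estimate (30), through
the concrete hyperboloidal foliation `Σ̃_τ(h♯_{R₁}) = {t*_KS = τ + h♯_{R₁}(y)}` terminating at `𝓘⁺`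
(the leaf form, hypothesis `hcor`) implies — and is equivalent to, `Kerr.scri_leaf_pointwise_decay_iff`
— the gr.S24 named fact `Literature.Geometry.Lorentzian.drsr_wave_pointwise_decay_kerr` of
`KerrWaveDecay.lean`** (instance `σ = Kerr.scriSlope` of
`drsr_wave_pointwise_decay_kerr_of_leaf_pointwise_decay`; `Kerr.scriHeight M a R₁ =
Kerr.cutoffHeight (Kerr.scriSlope M a) a R₁` definitionally). As printed (arXiv:1402.7034 =
Ann. of Math. 183 (2016), §3.3, Cor. 3.1): let `a₀, M, a, δ` be as in Thms. 3.1–3.2 (`M > 0`,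
`0 ≤ a₀ < M`, `|a| ≤ a₀`, `δ > 0`) and `R > r₊`; let `Σ̃₀` be an asymptotically hyperboloidal
hypersurface terminating at null infinity and `Σ̃_τ = φ_τ(Σ̃₀)`; then sufficiently regular solutions
of `□_{g_{a,M}} ψ = 0` satisfy `sup_{Σ̃_τ ∩ {r ≤ R}} |ψ − ψ_∞| ≤ C(a₀, M, δ, R) √E τ^{-3/2+δ}` (30),
where `E` denotes "an appropriate higher order weighted energy on `Σ̃₀` (or alternatively on an
asymptotically flat `Σ₀` in the past of `Σ̃₀`)" and `4π ψ_∞² = lim_{r'→∞} ∫_{Σ₀ ∩ {r = r'}} r⁻² ψ²`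
(Thm. 3.1, with the substitution `Σ₀ ↦ Σ̃₀` of §3.3); restated by Moschidis (arXiv:1509.08489,
§1.3.3) for any smooth spacelike `Σ̃₀` meeting `𝓗⁺` transversally and terminating at `𝓘⁺`, with
`C = C(a, M, Σ̃₀, δ)`, "for any smooth solution … with suitably decaying initial data on `Σ̃₀`".
**Leaf form (the hypothesis `hcor`; formerly the named fact
`Kerr.drsr_corollary_3_1_scri_pointwise_decay`, merged into `drsr_wave_pointwise_decay_kerr`, module
docstring).** For `|a| < M` there is `R₀ = R₀(M, a) > 0` such that for every `R₁ ≥ R₀`, every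
admissible wave `ψ` (`Literature.Geometry.Lorentzian.IsAdmissibleKerrWave`: smooth solution of
`□_g ψ = 0` on the Kerr–Schild exterior chart with data compactly supported in the open slice
`{t* = 0, r > r₊}`) whose data are supported in the coordinate ball `{‖y‖ ≤ R₁}`
(`Kerr.HasBallData`), every `δ > 0` and every `R > r₊`, there is a real constant
`C = C(M, a, R₁, δ, R, ψ)` with `|ψ(p)| ≤ C τ^{-3/2+δ}` for all `τ ≥ 1` and all leaf points
`p = Kerr.leafPoint (Kerr.scriHeight M a R₁) τ y = (τ + h♯_{R₁}(y), y)` of the exterior `{r > r₊}`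
with `r(p) ≤ R` — i.e. `sup_{Σ̃_τ(h♯_{R₁}) ∩ {r₊ < r ≤ R}} |ψ| ≤ C τ^{-3/2+δ}`.
Derivation of the leaf form from the printed statement: (i) for `R₁ ≥ R₀(M, a)`, `Σ̃₀(h♯_{R₁})` is
a smooth spacelike hypersurface of the exterior, equal to the Kerr–Schild slice `{t*_KS = 0}` on
`{r ≤ R₁}` (hence transversal to `𝓗⁺`) and terminating at `𝓘⁺` (`u → u_∞` along it), i.e. an
admissible hypersurface of the second kind, and `Σ̃_τ(h♯_{R₁}) = φ_τ Σ̃₀(h♯_{R₁})` for the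
`t*`-translations `φ_τ` (*The corrected foliation* in the module docstring of
`KerrHyperboloidalFlux.lean`; arXiv:1010.5132, §4.4); (ii) `{t* ≥ 0, r > r₊}` lies in the future
Cauchy development of the slice `S₀ = {t* = 0, r > r₊}`, so on
`{t* ≥ 0, r > r₊} ⊇ J⁺(Σ̃₀(h♯_{R₁})) ∩ {r > r₊}` the wave `ψ` coincides with the solution of the
Cauchy problem for the zero-extended (smooth, compactly supported) data on the horizon-penetrating
slice `{t* = 0}`, smooth up to and across `𝓗⁺` (arXiv:1010.5132, Prop. 4.5.1) — a "sufficiently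
regular solution" on `D⁺(Σ̃₀)` in the sense of arXiv:1402.7034, §4.1 —, and the part `{r > R₁}` of
`Σ̃₀(h♯_{R₁})` lies outside `J⁺(K)`, `K ⊆ S₀ ∩ {‖y‖ ≤ R₁} ⊆ S₀ ∩ {r ≤ R₁}` the support of the data
(loc. cit. (iii): future causal curves obey `dt ≥ S₀(r) |dr|` in Boyer–Lindquist time and the leaf
has slope `< S₀` beyond `R₁ ≥ R₀`), so the data induced by `ψ` on `Σ̃₀(h♯_{R₁})` are the given data
on `{r ≤ R₁}` and zero beyond: smooth and compactly supported, whence every higher-order weighted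
energy `E` of them is finite and `ψ_∞ = 0` (`ψ` vanishes identically on `Σ̃₀(h♯_{R₁}) ∩ {r ≥ r'}`
for `r'` large; §4.1: such solutions are smooth and compactly supported on every `Σ̃_τ`); (iii)
`C(a₀, M, δ, R) √E` with `a₀ := |a|` is absorbed into the existential constant, and the supremum is
restricted to the leaf points of the open exterior (the horizon sphere `Σ̃_τ ∩ 𝓗⁺` is dropped);
(iv) were (30) read for `τ ≥ τ₀` only, the range `[1, τ₀]` is covered by the uniform pointwise
bound `sup_{Σ̃_τ ∩ {r ≤ R}} |ψ| ≤ C'` (arXiv:1402.7034, p. 14: "uniform pointwise bounds on `|ψ|` …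
follow as an immediate consequence of the above Theorems in view of the Sobolev inequality applied
on each `Σ_τ`", with §3.3) and `inf_{[1,τ₀]} τ^{-3/2+δ} > 0`. The leaf form asserts less than the
source (unspecified dependence of the constant on `ψ`; exterior leaf points only; the class of
compactly supported data). Instance hypotheses `[Kerr.Facts] [Kerr.SliceFacts]` supply the Kerr
metric and its Levi-Civita connection.
**The reduction** (`drsr_wave_pointwise_decay_kerr_of_leaf_pointwise_decay`): on `{‖y‖ ≤ R}`,
`R ≤ R₁`, the leaf `Σ̃_τ(h♯_{R₁})` is the Kerr–Schild slice `{t* = τ}` (DRSR p. 51), so the leaf form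
bounds `|ψ(τ, y)|` there. DRSR arXiv:1402.7034, §3.3, Cor. 3.1 (30), §4.1 and p. 51. [cite: DafermosRodnianskiShlapentokhrothman2014, Cor. 3.1 (30) with §3.3, §4.1 and p. 51; Moschidis2016 §1.3.3; DafermosRodnianski2010KerrSmallA Prop. 4.5.1] -/
theorem drsr_wave_pointwise_decay_kerr_of_corollary_3_1_scri_pointwise
    (hcor : ∀ [Kerr.Facts] [Kerr.SliceFacts] (M a : ℝ), Kerr.IsSubextremal M a →
      ∃ R₀ : ℝ, 0 < R₀ ∧ ∀ R₁ : ℝ, R₀ ≤ R₁ →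
        ∀ ψ : Kerr.region a (Kerr.rPlus M a) → ℝ, IsAdmissibleKerrWave M a ψ →
          Kerr.HasBallData M a R₁ ψ → ∀ δ : ℝ, 0 < δ → ∀ R : ℝ, Kerr.rPlus M a < R →
            ∃ C : ℝ, ∀ τ : ℝ, 1 ≤ τ →
              ∀ (y : E3) (hy : Kerr.leafPoint (Kerr.scriHeight M a R₁) τ y ∈
                  Kerr.region a (Kerr.rPlus M a)),
                Kerr.radius a (Kerr.leafPoint (Kerr.scriHeight M a R₁) τ y) ≤ R →
                  |ψ ⟨Kerr.leafPoint (Kerr.scriHeight M a R₁) τ y, hy⟩| ≤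
                    C * τ ^ (-(3 / 2 : ℝ) + δ)) :
    drsr_wave_pointwise_decay_kerr :=
  drsr_wave_pointwise_decay_kerr_of_leaf_pointwise_decay Kerr.scriSlope
    fun M a hMa ↦ hcor M a hMa

/-- Corollary of the reduction: under Cor. 3.1 (30) for the foliation `Σ̃_τ(h♯_{R₁})` (leaf form),
an admissible wave tends to `0` along `t* → ∞` at every fixed spatial point `y` of the slice
`{r > r₊}` (compose with `drsr_wave_pointwise_decay_kerr.tendsto_zero` of `KerrWaveDecay.lean`).
DRSR arXiv:1402.7034, Cor. 3.1 (30). [cite: DafermosRodnianskiShlapentokhrothman2014, Cor. 3.1 (30)] -/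
theorem Kerr.tendsto_zero_of_scri_leaf_pointwise_decay
    (hcor : ∀ [Kerr.Facts] [Kerr.SliceFacts] (M a : ℝ), Kerr.IsSubextremal M a →
      ∃ R₀ : ℝ, 0 < R₀ ∧ ∀ R₁ : ℝ, R₀ ≤ R₁ →
        ∀ ψ : Kerr.region a (Kerr.rPlus M a) → ℝ, IsAdmissibleKerrWave M a ψ →
          Kerr.HasBallData M a R₁ ψ → ∀ δ : ℝ, 0 < δ → ∀ R : ℝ, Kerr.rPlus M a < R →
            ∃ C : ℝ, ∀ τ : ℝ, 1 ≤ τ →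
              ∀ (y : E3) (hy : Kerr.leafPoint (Kerr.scriHeight M a R₁) τ y ∈
                  Kerr.region a (Kerr.rPlus M a)),
                Kerr.radius a (Kerr.leafPoint (Kerr.scriHeight M a R₁) τ y) ≤ R →
                  |ψ ⟨Kerr.leafPoint (Kerr.scriHeight M a R₁) τ y, hy⟩| ≤
                    C * τ ^ (-(3 / 2 : ℝ) + δ))
    [Kerr.Facts] [Kerr.SliceFacts] {M a : ℝ} (hMa : Kerr.IsSubextremal M a)
    {ψ : Kerr.exterior M a → ℝ}
    (hψ : IsAdmissibleKerrWave M a ψ) {y : E3} (hy : y ∈ Kerr.slice a (Kerr.rPlus M a)) :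
    Tendsto (fun τ : ℝ ↦ ψ ⟨E4.ofTimeSpace τ y, Kerr.ofTimeSpace_mem_exterior_iff.2 hy⟩)
      atTop (𝓝 0) :=
  drsr_wave_pointwise_decay_kerr.tendsto_zero
    (drsr_wave_pointwise_decay_kerr_of_corollary_3_1_scri_pointwise hcor) hMa hψ hy

/-! ### The converse reduction: (30) through the leaves from the coordinate form -/

namespace Kerr

/-- A cut-off radial profile with far slope nonnegative beyond `R₁ ≥ 0` is nonnegative:
`k(r) = 0` for `r ≤ R₁` and `k(r) = ∫_{R₁}^r χ σ ≥ 0` for `r ≥ R₁`. [folklore] -/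
theorem cutoffProfile_nonneg {σ : ℝ → ℝ} {R₁ : ℝ} (hR : 0 ≤ R₁) (hσ : ∀ s, R₁ ≤ s → 0 ≤ σ s)
    (r : ℝ) : 0 ≤ cutoffProfile σ R₁ r := by
  rcases le_or_gt r R₁ with hr | hr
  · rw [cutoffProfile_eq_zero_of_le hR hr]
  · unfold cutoffProfile
    exact intervalIntegral.integral_nonneg hr.le fun s hs ↦
      mul_nonneg (Real.smoothTransition.nonneg _) (hσ s hs.1)

/-- The graph heights of a cut-off foliation whose far slope is nonnegative beyond `R₁ ≥ 0` are
nonnegative: the leaves `Σ̃_τ(h)` lie to the future of the Kerr–Schild slice `{t* = τ}` (DRSR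
arXiv:1402.7034, p. 51: "a hyperboloidal hypersurface which agrees with `Σ₀` on `{r ≤ R}` and
which lies to the future of `Σ₀`"). [folklore] -/
theorem cutoffHeight_nonneg {σ : ℝ → ℝ} {a R₁ : ℝ} (hR : 0 ≤ R₁) (hσ : ∀ s, R₁ ≤ s → 0 ≤ σ s)
    (y : E3) : 0 ≤ cutoffHeight σ a R₁ y :=
  cutoffProfile_nonneg hR hσ _

/-- The heights `h♯_{R₁}` of the foliation terminating at `𝓘⁺` are nonnegative for `R₁ > r₊`
(`σ♯ > 0` beyond `r₊`, `Kerr.scriSlope_pos`): its leaves lie to the future of the Kerr–Schild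
slices (DRSR arXiv:1402.7034, p. 51). [folklore] -/
theorem scriHeight_nonneg {M a R₁ : ℝ} (h : IsSubextremal M a) (hR₁ : rPlus M a < R₁) (y : E3) :
    0 ≤ scriHeight M a R₁ y :=
  cutoffHeight_nonneg (h.rPlus_pos.le.trans hR₁.le)
    (fun _ hs ↦ (scriSlope_pos h (hR₁.trans_le hs)).le) y

end Kerr

/-- **The converse reduction: DRSR's pointwise decay in coordinate form implies (30) through the
leaves of every cut-off graph foliation lying to the future of the slices.** Let `σ M a` be far
slopes that are nonnegative beyond `r₊` for subextremal `(M, a)`, and `h = Kerr.cutoffHeight (σ M a) a R₁`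
(`R₁ > r₊`), so that `h ≥ 0` (`Kerr.cutoffHeight_nonneg`). If
`Literature.Geometry.Lorentzian.drsr_wave_pointwise_decay_kerr` holds (`|ψ(t, y)| ≤ C t^{-3/2+δ}` at
the slice points with `‖y‖ ≤ R'`, `t ≥ 1`), then `|ψ(p)| ≤ C' τ^{-3/2+δ}` at every exterior leaf
point `p = Kerr.leafPoint h τ y = (τ + h(y), y)` with `r(p) ≤ R`, `τ ≥ 1`: indeed `p` is the slice
point `(t, y)` with `t = τ + h(y) ≥ τ ≥ 1` and `‖y‖ ≤ r(p) + |a| ≤ R + |a| =: R'`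
(`Kerr.norm_le_radius_add_abs`), so with `δ' = min δ 1` (exponent `-3/2 + δ' < 0`) the coordinate
estimate gives `|ψ(p)| ≤ C t^{-3/2+δ'} ≤ max(C, 0) τ^{-3/2+δ'} ≤ max(C, 0) τ^{-3/2+δ}`. Together with
`drsr_wave_pointwise_decay_kerr_of_leaf_pointwise_decay` this shows that (30) through the leaves of
such a foliation and the coordinate form are **equivalent** renderings of DRSR Cor. 3.1 (30) for
compactly supported data (the threshold `R₀` and the support radius `R₁` play no role in this
direction). DRSR arXiv:1402.7034, §3.3, Cor. 3.1 (30) and p. 51. [folklore] -/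
theorem leaf_pointwise_decay_of_drsr_wave_pointwise_decay_kerr (σ : ℝ → ℝ → ℝ → ℝ)
    (hσ : ∀ M a s : ℝ, Kerr.IsSubextremal M a → Kerr.rPlus M a < s → 0 ≤ σ M a s)
    (h : drsr_wave_pointwise_decay_kerr) :
    ∀ [Kerr.Facts] [Kerr.SliceFacts] (M a : ℝ), Kerr.IsSubextremal M a →
      ∃ R₀ : ℝ, 0 < R₀ ∧ ∀ R₁ : ℝ, R₀ ≤ R₁ →
        ∀ ψ : Kerr.region a (Kerr.rPlus M a) → ℝ, IsAdmissibleKerrWave M a ψ →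
          Kerr.HasBallData M a R₁ ψ → ∀ δ : ℝ, 0 < δ → ∀ R : ℝ, Kerr.rPlus M a < R →
            ∃ C : ℝ, ∀ τ : ℝ, 1 ≤ τ →
              ∀ (y : E3) (hy : Kerr.leafPoint (Kerr.cutoffHeight (σ M a) a R₁) τ y ∈
                  Kerr.region a (Kerr.rPlus M a)),
                Kerr.radius a (Kerr.leafPoint (Kerr.cutoffHeight (σ M a) a R₁) τ y) ≤ R →
                  |ψ ⟨Kerr.leafPoint (Kerr.cutoffHeight (σ M a) a R₁) τ y, hy⟩| ≤
                    C * τ ^ (-(3 / 2 : ℝ) + δ) := by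
  intro _ _ M a hMa
  -- threshold: any radius beyond the horizon (the heights are then nonnegative)
  refine ⟨Kerr.rPlus M a + 1, by linarith [hMa.rPlus_pos], fun R₁ hR₁ ψ hψ _hball δ hδ R _hR ↦ ?_⟩
  have hR₁' : Kerr.rPlus M a < R₁ := (lt_add_one _).trans_le hR₁
  have hR₁nn : 0 ≤ R₁ := hMa.rPlus_pos.le.trans hR₁'.le
  -- the coordinate estimate with exponent `-3/2 + δ' < 0`, `δ' = min δ 1`, on `{‖y‖ ≤ R + |a|}`
  set δ' : ℝ := min δ 1 with hδ'
  have hδ'pos : 0 < δ' := lt_min hδ one_pos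
  have hexp : -(3 / 2 : ℝ) + δ' ≤ 0 := by
    have : δ' ≤ 1 := min_le_right _ _
    linarith
  have hexp' : -(3 / 2 : ℝ) + δ' ≤ -(3 / 2 : ℝ) + δ := by
    have : δ' ≤ δ := min_le_left _ _
    linarith
  obtain ⟨C, hC⟩ := h M a hMa ψ hψ δ' hδ'pos (R + |a|)
  refine ⟨max C 0, fun τ hτ y hy hyR ↦ ?_⟩
  set hgt : E3 → ℝ := Kerr.cutoffHeight (σ M a) a R₁ with hhgt
  -- the leaf point is the slice point `(t, y)`, `t = τ + h(y) ≥ τ ≥ 1`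
  have h0 : 0 ≤ hgt y := Kerr.cutoffHeight_nonneg hR₁nn (fun s hs ↦ hσ M a s hMa (hR₁'.trans_le hs)) y
  set t : ℝ := τ + hgt y with ht
  have hpt : Kerr.leafPoint hgt τ y = E4.ofTimeSpace t y := rfl
  have hτt : τ ≤ t := le_add_of_nonneg_right h0
  have ht1 : 1 ≤ t := hτ.trans hτt
  have hτpos : 0 < τ := one_pos.trans_le hτ
  -- `‖y‖ ≤ r(p) + |a| ≤ R + |a|`
  have hy' : E4.ofTimeSpace t y ∈ Kerr.exterior M a := hpt ▸ hy
  have hrpos : 0 < Kerr.radius a (E4.ofTimeSpace 0 y) := by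
    rw [← Kerr.radius_ofTimeSpace a t y]
    exact Kerr.radius_pos_of_mem_region hy'
  have hnorm : ‖y‖ ≤ R + |a| := by
    have h1 := Kerr.norm_le_radius_add_abs hrpos
    have h2 : Kerr.radius a (E4.ofTimeSpace 0 y) ≤ R := by
      rw [← Kerr.radius_ofTimeSpace a t y, ← hpt]; exact hyR
    linarith
  -- the coordinate bound at `(t, y)` and the monotonicity of `t ↦ t^{-3/2+δ'}`
  have hbound : |ψ ⟨E4.ofTimeSpace t y, hy'⟩| ≤ C * t ^ (-(3 / 2 : ℝ) + δ') := hC t ht1 y hy' hnorm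
  have heq : (⟨Kerr.leafPoint hgt τ y, hy⟩ : Kerr.region a (Kerr.rPlus M a)) =
      ⟨E4.ofTimeSpace t y, hy'⟩ := Subtype.ext hpt
  rw [heq]
  have htpow : 0 ≤ t ^ (-(3 / 2 : ℝ) + δ') := Real.rpow_nonneg (zero_le_one.trans ht1) _
  calc |ψ ⟨E4.ofTimeSpace t y, hy'⟩| ≤ C * t ^ (-(3 / 2 : ℝ) + δ') := hbound
    _ ≤ max C 0 * t ^ (-(3 / 2 : ℝ) + δ') := mul_le_mul_of_nonneg_right (le_max_left _ _) htpow
    _ ≤ max C 0 * τ ^ (-(3 / 2 : ℝ) + δ') :=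
        mul_le_mul_of_nonneg_left (Real.rpow_le_rpow_of_nonpos hτpos hτt hexp) (le_max_right _ _)
    _ ≤ max C 0 * τ ^ (-(3 / 2 : ℝ) + δ) :=
        mul_le_mul_of_nonneg_left (Real.rpow_le_rpow_of_exponent_le hτ hexp') (le_max_right _ _)

/-- The two renderings of DRSR Cor. 3.1 (30) for compactly supported data — through the leaves of a
cut-off graph foliation to the future of the slices, and in coordinate form
(`Literature.Geometry.Lorentzian.drsr_wave_pointwise_decay_kerr`) — are equivalent. [folklore] -/
theorem drsr_wave_pointwise_decay_kerr_iff_leaf_pointwise_decay (σ : ℝ → ℝ → ℝ → ℝ)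
    (hσ : ∀ M a s : ℝ, Kerr.IsSubextremal M a → Kerr.rPlus M a < s → 0 ≤ σ M a s) :
    drsr_wave_pointwise_decay_kerr ↔
    ∀ [Kerr.Facts] [Kerr.SliceFacts] (M a : ℝ), Kerr.IsSubextremal M a →
      ∃ R₀ : ℝ, 0 < R₀ ∧ ∀ R₁ : ℝ, R₀ ≤ R₁ →
        ∀ ψ : Kerr.region a (Kerr.rPlus M a) → ℝ, IsAdmissibleKerrWave M a ψ →
          Kerr.HasBallData M a R₁ ψ → ∀ δ : ℝ, 0 < δ → ∀ R : ℝ, Kerr.rPlus M a < R →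
            ∃ C : ℝ, ∀ τ : ℝ, 1 ≤ τ →
              ∀ (y : E3) (hy : Kerr.leafPoint (Kerr.cutoffHeight (σ M a) a R₁) τ y ∈
                  Kerr.region a (Kerr.rPlus M a)),
                Kerr.radius a (Kerr.leafPoint (Kerr.cutoffHeight (σ M a) a R₁) τ y) ≤ R →
                  |ψ ⟨Kerr.leafPoint (Kerr.cutoffHeight (σ M a) a R₁) τ y, hy⟩| ≤
                    C * τ ^ (-(3 / 2 : ℝ) + δ) :=
  ⟨fun h _ _ M a hMa ↦ leaf_pointwise_decay_of_drsr_wave_pointwise_decay_kerr σ hσ h M a hMa,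
    fun h ↦ drsr_wave_pointwise_decay_kerr_of_leaf_pointwise_decay σ fun M a hMa ↦ h M a hMa⟩

namespace Kerr

/-- **(30) through the foliation `Σ̃_τ(h♯_{R₁})` from the coordinate form**: the leaf form of (30)
(the hypothesis of `drsr_wave_pointwise_decay_kerr_of_corollary_3_1_scri_pointwise`; formerly the
named fact `Kerr.drsr_corollary_3_1_scri_pointwise_decay`) follows from
`Literature.Geometry.Lorentzian.drsr_wave_pointwise_decay_kerr` (instance `σ = Kerr.scriSlope` of
`leaf_pointwise_decay_of_drsr_wave_pointwise_decay_kerr`, `Kerr.scriSlope_pos`). DRSR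
arXiv:1402.7034, §3.3, Cor. 3.1 (30). [folklore] -/
theorem scri_leaf_pointwise_decay_of_drsr_wave_pointwise_decay_kerr
    (h : Literature.Geometry.Lorentzian.drsr_wave_pointwise_decay_kerr) :
    ∀ [Facts] [SliceFacts] (M a : ℝ), IsSubextremal M a →
      ∃ R₀ : ℝ, 0 < R₀ ∧ ∀ R₁ : ℝ, R₀ ≤ R₁ →
        ∀ ψ : region a (rPlus M a) → ℝ, Literature.Geometry.Lorentzian.IsAdmissibleKerrWave M a ψ →
          HasBallData M a R₁ ψ → ∀ δ : ℝ, 0 < δ → ∀ R : ℝ, rPlus M a < R →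
            ∃ C : ℝ, ∀ τ : ℝ, 1 ≤ τ →
              ∀ (y : E3) (hy : leafPoint (scriHeight M a R₁) τ y ∈ region a (rPlus M a)),
                radius a (leafPoint (scriHeight M a R₁) τ y) ≤ R →
                  |ψ ⟨leafPoint (scriHeight M a R₁) τ y, hy⟩| ≤ C * τ ^ (-(3 / 2 : ℝ) + δ) :=
  fun M a hMa ↦ leaf_pointwise_decay_of_drsr_wave_pointwise_decay_kerr scriSlope
    (fun _ _ _ hMa hs ↦ (scriSlope_pos hMa hs).le) h M a hMa

/-- **The leaf form of DRSR Cor. 3.1 (30) for `Σ̃_τ(h♯_{R₁})` is equivalent to the gr.S24 named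
fact `Literature.Geometry.Lorentzian.drsr_wave_pointwise_decay_kerr`** (both render the printed
estimate (30) for compactly supported data; `drsr_wave_pointwise_decay_kerr_of_corollary_3_1_scri_pointwise`
and `scri_leaf_pointwise_decay_of_drsr_wave_pointwise_decay_kerr`). This equivalence is the reason
why the leaf form, first vendored as the named fact `Kerr.drsr_corollary_3_1_scri_pointwise_decay`,
was merged back into `drsr_wave_pointwise_decay_kerr` (D-0026 review of the decomposition; module
docstring). [folklore] -/
theorem scri_leaf_pointwise_decay_iff :
    (∀ [Facts] [SliceFacts] (M a : ℝ), IsSubextremal M a →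
      ∃ R₀ : ℝ, 0 < R₀ ∧ ∀ R₁ : ℝ, R₀ ≤ R₁ →
        ∀ ψ : region a (rPlus M a) → ℝ, Literature.Geometry.Lorentzian.IsAdmissibleKerrWave M a ψ →
          HasBallData M a R₁ ψ → ∀ δ : ℝ, 0 < δ → ∀ R : ℝ, rPlus M a < R →
            ∃ C : ℝ, ∀ τ : ℝ, 1 ≤ τ →
              ∀ (y : E3) (hy : leafPoint (scriHeight M a R₁) τ y ∈ region a (rPlus M a)),
                radius a (leafPoint (scriHeight M a R₁) τ y) ≤ R →
                  |ψ ⟨leafPoint (scriHeight M a R₁) τ y, hy⟩| ≤ C * τ ^ (-(3 / 2 : ℝ) + δ)) ↔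
      Literature.Geometry.Lorentzian.drsr_wave_pointwise_decay_kerr :=
  ⟨fun h ↦ drsr_wave_pointwise_decay_kerr_of_corollary_3_1_scri_pointwise fun M a hMa ↦ h M a hMa,
    fun h ↦ by
      intro _ _ M a hMa
      exact scri_leaf_pointwise_decay_of_drsr_wave_pointwise_decay_kerr h M a hMa⟩

end Kerr

end Literature.Geometry.Lorentzian

end
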